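import Mathlib.Analysis.InnerProductSpace.PiL2
import Mathlib.Algebra.Order.Chebyshev
import Literature.MathematicalPhysics.QuantumFieldTheory.Balaban1983to89.B4Eq19LatticeDirichletReplacement
import Literature.MathematicalPhysics.QuantumFieldTheory.Balaban1983to89.B4Eq19LatticeHarmonicDecay
import HarnessLib

/-!
# Route `UnitScaleTilt`, crux K1 «MinimiserStabilityRegPr» (stmt-QuantumFields-19200), EX row (5) `h3` (STOREY H), H2 pipeline (ii) — programme **H2-LOC**, brick **(C2a):
# VECTOR-VALUED FLAT LATTICE TOOLS ON `ℤ^d`** — the `W`-valued editions (any finite-dimensional real inner-product fibre `W`) of three scalar lit facts, read through an orthonormal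
# basis of `W`: the Dirichlet problem on a box (lit ✓`B4Eq19LatticeDirichletReplacement.exists_dirichlet`), the energy decay of `κ`-harmonic functions
# (lit ✓`B4Eq19LatticeHarmonicDecay.harmonic_decay`), and the zero-extension Poincaré inequality on a box (direct).

Cell `ym3-torus` (HUMAN RULING D-0037; rung R3 = SU(2) YM₃ on T³ — NOT d = 4, NOT infinite volume, NOT a mass gap, NOT Clay).  Width seat `ym3-torus-px19` (gen 16);
`--supports stmt-QuantumFields-19200 --as helper`; count-neutral; THEOREMS ONLY (0 `def`, 0 `sorry`, default heartbeats).  ★CHAIR WORD №60 ∕ ★★OWNER RULING №52: road of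
record for pipeline (ii) = H2-LOC (19200 evidence #56); (C1) = ✓∕⧗`Prop7CovariantLatticeCaccioppoli`; THIS = (C2a), the flat half of the comparison brick (C2).

THE FLAT OPERATORS (written out; no `def`): `(L^κ h)(y) = Σ_μ (2h(y) − h(y+e_μ) − h(y−e_μ)) + κh(y)` on `h : ℤ^d → W` (lit's `lop κ` componentwise), plain differences
`h(y+e_μ) − h(y)` (lit's `fdiff`), box `Q_r(z)` = lit's `box z r`.

WHAT IS PROVED (ns `Summit.QuantumFields.YangMills.Theorems.Prop7LatticeVectorFlatTools`; `W` finite-dimensional real inner-product space).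
* §1 `inner_flatLop` (a coordinate of `L^κ h` is `lop κ` of the coordinate), `sum_sq_inner_fdiff` (Parseval for differences: `Σ_i Σ_Q Σ_μ ⟪b_i, h₊ − h⟫² = Σ_Q Σ_μ ‖h₊ − h‖²`).
* §2 ★ `exists_dirichlet_W` — `κ > 0`: every `ψ : ℤ^d → W` has `w` with `w = 0` off `Q_r(z)` and `L^κ w = ψ` on `Q_r(z)` (lit, coordinate by coordinate, reassembled by ✓`OrthonormalBasis.sum_repr'`).
* §3 ★★ `harmonic_decay_W` — `κ ≥ 0`, `0 ≤ ρ ≤ r`, `L^κ h = 0` on `Q_{r+1}(z)` ⟹ `Σ_{Q_ρ}Σ_μ‖h₊ − h‖² ≤ A_d·((ρ+1)∕(r+1))^d·Σ_{Q_r}Σ_μ‖h₊ − h‖²`, `A_d = 2^d(1+56d)^d(8(d+1))^{d+1}` (lit's constant).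
* §4 `sum_le_sum_of_vanish_off` (a non-negative function vanishing off `T` sums over any `S` to at most its sum over `T`); ★★ `poincare_zero_ext_W` — `d ≥ 1`, `r ≥ 0`, `w = 0` off `Q_r(z)` ⟹
  `Σ_{Q_r(z)} ‖w‖² ≤ (2r+2)²·Σ_{Q_{r+1}(z)} Σ_μ ‖w₊ − w‖²` (telescope `2r+2` steps in direction `0` to leave the box, Cauchy–Schwarz, translate).
HYP-SAT (★★OWNER RULING №42): hypotheses are equations∕vanishing conditions on displayed functions (inhabited by `0`); conclusions explicit; no `Prop` placeholder.
HONEST SCOPE.  [folklore] lattice calculus ([Giaquinta1984] Ch. III §2); the covariant comparison (C2b), the step∕Morrey bricks (C3, px21 g16), the assembly (C4), the torus transfer (C5)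
and the `ω₁` knit (C6) are NOT here; nothing of `hHlocV`, `hWsup`, H2, `h3`, norm_G, EX, 19200 or the rung is proved; the Yang–Mills mass gap is NOT proved.

References: T. Bałaban, CMP **96** (1984) 223–250 [Balaban1984PropagatorsII] ((1.9) p.226); CMP **99** (1985) 389–434 [Balaban1985BackgroundPropagators] (Thm 3.1 (3.43) p.398);
M. Giaquinta, *Multiple integrals in the calculus of variations and nonlinear elliptic systems* (1983) [Giaquinta1984] (Ch. III §2 pp.76–79).
-/

set_option autoImplicit false

noncomputable section

open scoped BigOperators InnerProductSpace
open Finset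

namespace Summit.QuantumFields.YangMills.Theorems.Prop7LatticeVectorFlatTools

open Literature.MathematicalPhysics.QuantumFieldTheory.Balaban1983to89
open B4Eq19LatticeOperators (Zd unitVec box mem_box box_mono box_subset_box self_mem_box add_unitVec_mem_box sub_unitVec_mem_box abs_unitVec_apply_le sum_box_add_right
  lop lop_apply dvg fdiff fdiff_apply gradSq gradSq_def unitVec_apply_self unitVec_apply_ne)
open B4Eq19LatticeDirichletReplacement (exists_dirichlet)
open B4Eq19LatticeHarmonicDecay (harmonic_decay)

variable {d : ℕ} {W : Type*} [NormedAddCommGroup W] [InnerProductSpace ℝ W] [FiniteDimensional ℝ W]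

/-! ## §1 Coordinates -/

omit [FiniteDimensional ℝ W] in
/-- A coordinate of the flat vector operator is the scalar operator of the coordinate: `⟪e, (L^κ h)(y)⟫ = (lop κ ⟪e, h⟫)(y)`. [folklore] [cite: Giaquinta1984, Ch. III §2 p.77] -/
theorem inner_flatLop (e : W) (κ : ℝ) (h : Zd d → W) (y : Zd d) :
    ⟪e, (∑ μ, ((2 : ℝ) • h y - h (y + unitVec μ) - h (y - unitVec μ))) + κ • h y⟫_ℝ = lop κ (fun x => ⟪e, h x⟫_ℝ) y := by
  rw [lop_apply, inner_add_right, inner_sum, real_inner_smul_right]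
  congr 1
  refine Finset.sum_congr rfl fun μ _ => ?_
  rw [inner_sub_right, inner_sub_right, real_inner_smul_right]

omit [FiniteDimensional ℝ W] in
/-- **Parseval for differences**: for an orthonormal basis `b` of `W`, `Σ_i Σ_{y∈Q} Σ_μ (⟪b_i, h(y+e_μ)⟫ − ⟪b_i, h(y)⟫)² = Σ_{y∈Q} Σ_μ ‖h(y+e_μ) − h(y)‖²`, i.e.
`Σ_i gradSq ⟪b_i, h⟫ Q = Σ_Q Σ_μ ‖h₊ − h‖²`. [folklore] [cite: Giaquinta1984, Ch. III §2 p.76] -/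
theorem sum_gradSq_inner_eq {ι : Type*} [Fintype ι] (b : OrthonormalBasis ι ℝ W) (h : Zd d → W) (Q : Finset (Zd d)) :
    ∑ i, gradSq (fun x => ⟪b i, h x⟫_ℝ) Q = ∑ y ∈ Q, ∑ μ, ‖h (y + unitVec μ) - h y‖ ^ 2 := by
  simp only [gradSq_def, fdiff_apply]
  rw [Finset.sum_comm]
  refine Finset.sum_congr rfl fun y _ => ?_
  rw [Finset.sum_comm]
  refine Finset.sum_congr rfl fun μ _ => ?_
  simp_rw [← inner_sub_right]
  exact b.sum_sq_inner_right _

/-! ## §2 ★ The Dirichlet problem on a box, vector-valued -/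

/-- ★ **THE VECTOR DIRICHLET PROBLEM ON A BOX**: for `κ > 0`, every `ψ : ℤ^d → W` has `w : ℤ^d → W` with `w = 0` off `Q_r(z)` and `(L^κ w)(y) = ψ(y)` on `Q_r(z)`
(lit ✓`exists_dirichlet` for each coordinate `⟪b_i, ψ⟫`, reassembled). [folklore] [cite: Giaquinta1984, Ch. III §2 p.78] -/
theorem exists_dirichlet_W {κ : ℝ} (hκ : 0 < κ) (z : Zd d) (r : ℤ) (ψ : Zd d → W) :
    ∃ w : Zd d → W, (∀ y ∉ box z r, w y = 0) ∧
      (∀ y ∈ box z r, (∑ μ, ((2 : ℝ) • w y - w (y + unitVec μ) - w (y - unitVec μ))) + κ • w y = ψ y) := by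
  classical
  set b := stdOrthonormalBasis ℝ W with hb
  have hcoord : ∀ i, ∃ wi : Zd d → ℝ, (∀ y ∉ box z r, wi y = 0) ∧ (∀ y ∈ box z r, lop κ wi y = ⟪b i, ψ y⟫_ℝ) :=
    fun i => exists_dirichlet hκ z r (fun y => ⟪b i, ψ y⟫_ℝ)
  choose wi hwi0 hwi using hcoord
  refine ⟨fun y => ∑ i, wi i y • b i, fun y hy => ?_, fun y hy => ?_⟩
  · simp only [hwi0 _ y hy, zero_smul, Finset.sum_const_zero]
  · -- compare coordinates
    have key : ∀ j, ⟪b j, (∑ μ, ((2 : ℝ) • (∑ i, wi i y • b i) - (∑ i, wi i (y + unitVec μ) • b i) - (∑ i, wi i (y - unitVec μ) • b i))) +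
        κ • (∑ i, wi i y • b i)⟫_ℝ = ⟪b j, ψ y⟫_ℝ := by
      intro j
      rw [inner_flatLop (b j) κ (fun x => ∑ i, wi i x • b i) y]
      have hc : (fun x => ⟪b j, ∑ i, wi i x • b i⟫_ℝ) = wi j := by
        funext x
        rw [inner_sum]
        simp_rw [real_inner_smul_right]
        rw [Finset.sum_eq_single j]
        · rw [show ⟪b j, b j⟫_ℝ = 1 from by rw [real_inner_self_eq_norm_sq, b.orthonormal.1 j, one_pow], mul_one]
        · intro i _ hij
          rw [show ⟪b j, b i⟫_ℝ = 0 from b.orthonormal.2 (Ne.symm hij), mul_zero]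
        · intro hj; exact absurd (Finset.mem_univ j) hj
      rw [hc]
      exact hwi j y hy
    -- two vectors with equal coordinates are equal
    rw [← b.sum_repr' ((∑ μ, ((2 : ℝ) • (∑ i, wi i y • b i) - (∑ i, wi i (y + unitVec μ) • b i) - (∑ i, wi i (y - unitVec μ) • b i))) +
        κ • (∑ i, wi i y • b i)), ← b.sum_repr' (ψ y)]
    exact Finset.sum_congr rfl fun j _ => by rw [key j]

/-! ## §3 ★★ Energy decay of flat harmonic vector functions -/

/-- ★★ **ENERGY DECAY FOR `L^κ`-HARMONIC VECTOR FUNCTIONS ON `ℤ^d`**: for `κ ≥ 0`, integers `0 ≤ ρ ≤ r`, and `h : ℤ^d → W` with `L^κ h = 0` on `Q_{r+1}(z)`,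
`Σ_{Q_ρ(z)}Σ_μ ‖h(y+e_μ) − h(y)‖² ≤ A_d·((ρ+1)∕(r+1))^d·Σ_{Q_r(z)}Σ_μ ‖h(y+e_μ) − h(y)‖²`, `A_d = 2^d(1+56d)^d(8(d+1))^{d+1}` — lit ✓`harmonic_decay` for each coordinate
`⟪b_i, h⟫` (a scalar `κ`-harmonic function), summed by §1. [folklore] [cite: Giaquinta1984, Ch. III §2 (2.5) p.78; Balaban1984PropagatorsII, (1.9) p.226] -/
theorem harmonic_decay_W {κ : ℝ} (hκ : 0 ≤ κ) {z : Zd d} {ρ r : ℤ} (hρ : 0 ≤ ρ) (hρr : ρ ≤ r) (h : Zd d → W)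
    (hh : ∀ y ∈ box z (r + 1), (∑ μ, ((2 : ℝ) • h y - h (y + unitVec μ) - h (y - unitVec μ))) + κ • h y = 0) :
    ∑ y ∈ box z ρ, ∑ μ, ‖h (y + unitVec μ) - h y‖ ^ 2 ≤
      (2 : ℝ) ^ d * (1 + 56 * d) ^ d * (8 * ((d : ℝ) + 1)) ^ (d + 1) * (((ρ : ℝ) + 1) / ((r : ℝ) + 1)) ^ d * ∑ y ∈ box z r, ∑ μ, ‖h (y + unitVec μ) - h y‖ ^ 2 := by
  classical
  set b := stdOrthonormalBasis ℝ W with hb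
  rw [← sum_gradSq_inner_eq b h (box z ρ), ← sum_gradSq_inner_eq b h (box z r), Finset.mul_sum]
  refine Finset.sum_le_sum fun i _ => ?_
  refine harmonic_decay hκ hρ hρr (fun x => ⟪b i, h x⟫_ℝ) fun y hy => ?_
  rw [← inner_flatLop (b i) κ h y, hh y hy, inner_zero_right]

/-! ## §4 ★★ The zero-extension Poincaré inequality on a box -/

omit [FiniteDimensional ℝ W] in
/-- A non-negative function that vanishes off `T` sums over any finset `S` to at most its sum over `T`. [folklore] [cite: Giaquinta1984, Ch. III §1 p.64] -/
theorem sum_le_sum_of_vanish_off {α : Type*} [DecidableEq α] (S T : Finset α) (f : α → ℝ) (hf0 : ∀ a, 0 ≤ f a) (hfT : ∀ a ∉ T, f a = 0) :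
    ∑ a ∈ S, f a ≤ ∑ a ∈ T, f a := by
  calc ∑ a ∈ S, f a = ∑ a ∈ S ∩ T, f a + ∑ a ∈ S \ T, f a := (Finset.sum_inter_add_sum_sdiff S T f).symm
    _ = ∑ a ∈ S ∩ T, f a := by
        rw [add_eq_left]
        exact Finset.sum_eq_zero fun a ha => hfT a (Finset.mem_sdiff.1 ha).2
    _ ≤ ∑ a ∈ T, f a := Finset.sum_le_sum_of_subset_of_nonneg Finset.inter_subset_right fun a _ _ => hf0 a

omit [InnerProductSpace ℝ W] [FiniteDimensional ℝ W] in
/-- ★★ **ZERO-EXTENSION POINCARÉ ON A BOX** (`d ≥ 1`, `r ≥ 0`): if `w : ℤ^d → W` vanishes off `Q_r(z)` then `Σ_{Q_r(z)} ‖w‖² ≤ (2r+2)²·Σ_{Q_{r+1}(z)} Σ_μ ‖w(y+e_μ) − w(y)‖²`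
(telescope `w(y) = −Σ_{k<2r+2}(w(y+(k+1)e₀) − w(y+ke₀))`, the last point being outside the box; Cauchy–Schwarz; each translate of the bond sum is at most the full one, which lives
on `Q_{r+1}(z)`). [folklore] [cite: Giaquinta1984, Ch. III §1 (1.3) p.65] -/
theorem poincare_zero_ext_W (hd : 1 ≤ d) {z : Zd d} {r : ℤ} (hr : 0 ≤ r) (w : Zd d → W) (hw0 : ∀ y ∉ box z r, w y = 0) :
    ∑ y ∈ box z r, ‖w y‖ ^ 2 ≤ ((2 * r + 2 : ℤ) : ℝ) ^ 2 * ∑ y ∈ box z (r + 1), ∑ μ, ‖w (y + unitVec μ) - w y‖ ^ 2 := by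
  classical
  set μ₀ : Fin d := ⟨0, hd⟩ with hμ₀
  set N : ℕ := (2 * r + 2).toNat with hN
  have hN' : (N : ℤ) = 2 * r + 2 := by rw [hN, Int.toNat_of_nonneg (by linarith)]
  have hNR : (N : ℝ) = ((2 * r + 2 : ℤ) : ℝ) := by exact_mod_cast hN'
  -- the difference in direction `μ₀`
  set D : Zd d → ℝ := fun y => ‖w (y + unitVec μ₀) - w y‖ with hD
  have hD0 : ∀ y, 0 ≤ D y := fun y => norm_nonneg _
  -- leaving the box after `N` steps
  have hout : ∀ y ∈ box z r, y + (N : ℤ) • unitVec μ₀ ∉ box z r := by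
    intro y hy hmem
    rw [mem_box] at hy hmem
    have h1 := hy μ₀
    have h2 := hmem μ₀
    simp only [Pi.add_apply, Pi.smul_apply, unitVec_apply_self, smul_eq_mul, mul_one] at h2
    rw [hN'] at h2
    have := abs_le.1 h1
    have := abs_le.1 h2
    linarith
  -- telescoping: `w(y) = -(Σ_{k<N} (w(y+(k+1)e₀) − w(y+ke₀)))` for `y ∈ Q_r(z)`
  have htel : ∀ y ∈ box z r, w y = -∑ k ∈ Finset.range N, (w (y + ((k : ℤ) + 1) • unitVec μ₀) - w (y + (k : ℤ) • unitVec μ₀)) := by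
    intro y hy
    have ht := Finset.sum_range_sub (fun k : ℕ => w (y + (k : ℤ) • unitVec μ₀)) N
    simp only [Nat.cast_zero, zero_smul, add_zero] at ht
    have hcast : ∀ k : ℕ, ((k + 1 : ℕ) : ℤ) = (k : ℤ) + 1 := fun k => by push_cast; ring
    simp only [hcast] at ht
    rw [ht, hw0 _ (hout y hy), zero_sub, neg_neg]
  -- pointwise: `‖w y‖² ≤ N · Σ_{k<N} D(y + k e₀)²`
  have hpt : ∀ y ∈ box z r, ‖w y‖ ^ 2 ≤ N * ∑ k ∈ Finset.range N, D (y + (k : ℤ) • unitVec μ₀) ^ 2 := by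
    intro y hy
    have h1 : ‖w y‖ ≤ ∑ k ∈ Finset.range N, D (y + (k : ℤ) • unitVec μ₀) := by
      rw [htel y hy, norm_neg]
      refine (norm_sum_le _ _).trans (Finset.sum_le_sum fun k _ => le_of_eq ?_)
      have e1 : y + ((k : ℤ) + 1) • unitVec μ₀ = y + (k : ℤ) • unitVec μ₀ + unitVec μ₀ := by rw [add_smul, one_smul, add_assoc]
      rw [e1]
    have h2 := sq_sum_le_card_mul_sum_sq (s := Finset.range N) (f := fun k => D (y + (k : ℤ) • unitVec μ₀))
    rw [Finset.card_range] at h2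
    calc ‖w y‖ ^ 2 ≤ (∑ k ∈ Finset.range N, D (y + (k : ℤ) • unitVec μ₀)) ^ 2 :=
          pow_le_pow_left₀ (norm_nonneg _) h1 2
      _ ≤ N * ∑ k ∈ Finset.range N, D (y + (k : ℤ) • unitVec μ₀) ^ 2 := h2
  -- `D²` vanishes off `Q_{r+1}(z)`
  have hDsupp : ∀ y ∉ box z (r + 1), D y ^ 2 = 0 := by
    intro y hy
    have h1 : w y = 0 := hw0 y fun h => hy (box_mono z (by linarith) h)
    have h2 : w (y + unitVec μ₀) = 0 := hw0 _ fun h => hy (by have := sub_unitVec_mem_box h μ₀; rwa [add_sub_cancel_right] at this)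
    simp [hD, h1, h2]
  -- each translate of `Σ D²` over `Q_r` is at most the full sum over `Q_{r+1}`
  have htrans : ∀ k : ℕ, ∑ y ∈ box z r, D (y + (k : ℤ) • unitVec μ₀) ^ 2 ≤ ∑ y ∈ box z (r + 1), D y ^ 2 := by
    intro k
    rw [sum_box_add_right (fun y => D y ^ 2)]
    exact sum_le_sum_of_vanish_off _ _ (fun y => D y ^ 2) (fun y => sq_nonneg _) hDsupp
  -- `Σ_{Q_{r+1}} D² ≤ Σ_{Q_{r+1}} Σ_μ ‖w₊ − w‖²`
  have hDle : ∑ y ∈ box z (r + 1), D y ^ 2 ≤ ∑ y ∈ box z (r + 1), ∑ μ, ‖w (y + unitVec μ) - w y‖ ^ 2 :=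
    Finset.sum_le_sum fun y _ => Finset.single_le_sum (f := fun μ => ‖w (y + unitVec μ) - w y‖ ^ 2) (fun _ _ => sq_nonneg _) (Finset.mem_univ μ₀)
  have hS0 : 0 ≤ ∑ y ∈ box z (r + 1), D y ^ 2 := Finset.sum_nonneg fun _ _ => sq_nonneg _
  calc ∑ y ∈ box z r, ‖w y‖ ^ 2 ≤ ∑ y ∈ box z r, (N * ∑ k ∈ Finset.range N, D (y + (k : ℤ) • unitVec μ₀) ^ 2) := Finset.sum_le_sum hpt
    _ = N * ∑ k ∈ Finset.range N, ∑ y ∈ box z r, D (y + (k : ℤ) • unitVec μ₀) ^ 2 := by rw [← Finset.mul_sum, Finset.sum_comm]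
    _ ≤ N * ∑ _k ∈ Finset.range N, ∑ y ∈ box z (r + 1), D y ^ 2 :=
        mul_le_mul_of_nonneg_left (Finset.sum_le_sum fun k _ => htrans k) (Nat.cast_nonneg N)
    _ = (N : ℝ) ^ 2 * ∑ y ∈ box z (r + 1), D y ^ 2 := by rw [Finset.sum_const, Finset.card_range, nsmul_eq_mul]; ring
    _ ≤ ((2 * r + 2 : ℤ) : ℝ) ^ 2 * ∑ y ∈ box z (r + 1), ∑ μ, ‖w (y + unitVec μ) - w y‖ ^ 2 := by
        rw [hNR]; exact mul_le_mul_of_nonneg_left hDle (sq_nonneg _)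

end Summit.QuantumFields.YangMills.Theorems.Prop7LatticeVectorFlatTools

end
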